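import Mathlib
import Summits.Schanuel.Schanuel.Theorems.RigidCoreMinimalCounterexampleInAclNoFullLineSlice
import Literature.RingTheory.NoetherNormalization.GenericLinearForms

/-!
# FCS⁺ ⟹ FCS♮⁺ — crux stmt-Schanuel-0969 `RigidCore.MinimalCounterexampleInAcl`

Line `kernel-arithmetic-selection` (lead prover-line-stmt-Schanuel-0969-c16-0), `--supports stmt-Schanuel-0969`; the
registered stub `stub_genericSparsity_of_fcsPlus` (gen 34, PROVABLE): gen 31's free coset-line sparsity FCS⁺ (for
families on an ARBITRARY Zariski closed `W ⊆ ℂ^ι × ℂ^ι` with `dim W + rank Λ < #ι`) implies the `K`-generic form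
FCS♮⁺ (families all of whose points `P_j = (q_j, e^{q_j})` have the same type over a field of constants `K = ℚ(ev)`,
with a coordinate set `T`, `#T + rank Λ < #ι`, over which — together with `K` — every coordinate of `P_{j₀}` is
algebraic).  So the gen-34 open stub FCS♮⁺ is WEAKER than the gen-31 open stub FCS⁺.

The proof is the generic slice variety: `W :=` the `K`-locus `kLocus[K, P_{j₀}]` of `P_{j₀}` (Theorems/…NoFullLineSlice)
is Zariski closed (`isZariskiClosed_kLocus`), has `zariskiDim ℂ W ≤ trdeg_K K[P_{j₀}] ≤ #(P_{j₀} '' T) ≤ #T`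
(`zariskiDim_kLocus_le` and `Literature.RingTheory.NoetherNormalization.trdeg_adjoin_le_of_forall_isAlgebraic`), and
contains every `P_j`, `j ∈ J`, because every `ℚ`-relation of `(ev, P_{j₀})` holds at `(ev, P_j)`
(`mem_kLocus_adjoin_of_relations`); then FCS⁺ applies verbatim.

* `zariskiDim_kLocus_le_card_image` — `dim kLocus[K, P] ≤ #T` if every coordinate of `P` is algebraic over `K[P '' T]`;
* `genericSliceVariety` — the `ℚ(ev)`-locus of `P₀` as a closed set of dimension `≤ #T` through all points of the type of `P₀`;
* `stub_genericSparsity_of_fcsPlus` — the registered implication FCS⁺ ⟹ FCS♮⁺.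

References: H. Matsumura, *Commutative Ring Theory*, CUP 1986, Thm 5.6 (dimension of an affine domain is its
transcendence degree).
-/

noncomputable section

set_option linter.dupNamespace false

open Complex Set MvPolynomial

namespace Summit.Schanuel.Schanuel.Cruxes.MinimalCounterexampleInAcl.KernelArithmeticSelection

open Literature.NumberTheory.Transcendental (IsZariskiClosed zariskiDim)

/-- The `K`-locus `kLocus[K, P]` of a point `P ∈ ℂ^σ` (local notation, as in Theorems/…NoFullLineSlice): the common
zeros in `ℂ^σ` of the `K`-polynomial relations of `P`. -/
local notation3 "kLocus[" K ", " P "]" =>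
  MvPolynomial.zeroLocus ℂ (RingHom.ker (MvPolynomial.aeval (R := K) (S₁ := ℂ) P))

/-! ## Dimension of the `K`-locus over a finite set of coordinates -/

section KLocus

variable {σ : Type} [Fintype σ] {K : Type} [Field K] [Algebra K ℂ] {P : σ → ℂ}

/-- **The `K`-locus of a point algebraic over finitely many of its coordinates has dimension `≤ #T`**: if every
coordinate of `P` is algebraic over `K[P '' T]` for a finite set `T` of coordinate indices, then
`zariskiDim ℂ (kLocus[K, P]) ≤ #T` (`zariskiDim_kLocus_le`: the dimension is at most `trdeg_K K[P] ≤ #(P '' T) ≤ #T`).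
[cite: Matsumura1987, Thm 5.6] -/
theorem zariskiDim_kLocus_le_card_image (T : Finset σ)
    (halg : ∀ i, IsAlgebraic (Algebra.adjoin K (P '' (↑T : Set σ))) (P i)) :
    zariskiDim ℂ (kLocus[K, P]) ≤ ((T.card : ℕ) : WithBot ℕ∞) := by
  refine (zariskiDim_kLocus_le (K := K) (P := P)).trans ?_
  have h : Algebra.trdeg K (Algebra.adjoin K (Set.range P)) ≤ Cardinal.mk (P '' (↑T : Set σ)) :=
    Literature.RingTheory.NoetherNormalization.trdeg_adjoin_le_of_forall_isAlgebraic (by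
      rintro _ ⟨i, rfl⟩; exact halg i)
  have hT : Cardinal.mk (P '' (↑T : Set σ)) ≤ (T.card : Cardinal) := by
    refine Cardinal.mk_image_le.trans (le_of_eq ?_)
    simp only [Finset.coe_sort_coe, Cardinal.mk_coe_finset]
  have h2 : Cardinal.toNat (Algebra.trdeg K (Algebra.adjoin K (Set.range P))) ≤ T.card := by
    have := Cardinal.toNat_le_toNat (h.trans hT) (Cardinal.natCast_lt_aleph0 (n := T.card))
    simpa only [Cardinal.toNat_natCast] using this
  exact_mod_cast h2

end KLocus

/-! ## The generic slice variety -/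

/-- **THE GENERIC SLICE VARIETY.**  If every coordinate of `P₀ ∈ ℂ^σ` is algebraic over `ℚ(ev)[P₀ '' T]` for a finite set
`T` of coordinate indices, there is a Zariski closed `W ⊆ ℂ^σ` with `zariskiDim ℂ W ≤ #T` (the `ℚ(ev)`-locus of `P₀`)
containing every point `P'` at which all `ℚ`-polynomial relations of `(ev, P₀)` hold. [cite: Matsumura1987, Thm 5.6] -/
theorem genericSliceVariety {κ σ : Type} [Fintype σ] (ev : κ → ℂ) (P₀ : σ → ℂ) (T : Finset σ)
    (halg : ∀ v : σ, IsAlgebraic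
      ↥(Algebra.adjoin ↥(IntermediateField.adjoin ℚ (Set.range ev)) (P₀ '' (↑T : Set σ))) (P₀ v)) :
    ∃ W : Set (σ → ℂ), IsZariskiClosed ℂ W ∧ zariskiDim ℂ W ≤ ((T.card : ℕ) : WithBot ℕ∞) ∧
      ∀ P' : σ → ℂ, (∀ H : MvPolynomial (κ ⊕ σ) ℚ, MvPolynomial.aeval (Sum.elim ev P₀) H = 0 →
        MvPolynomial.aeval (Sum.elim ev P') H = 0) → P' ∈ W :=
  ⟨kLocus[IntermediateField.adjoin ℚ (Set.range ev), P₀], isZariskiClosed_kLocus,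
    zariskiDim_kLocus_le_card_image T halg, fun _ h => mem_kLocus_adjoin_of_relations ev h⟩

/-! ## FCS⁺ ⟹ FCS♮⁺ -/

/-- **Registered stub `stub_genericSparsity_of_fcsPlus` (FCS⁺ ⟹ FCS♮⁺, PROVED; gen 34): the gen-34 open stub FCS♮⁺ is
WEAKER than gen 31's FCS⁺.**  Given the data of FCS♮⁺, the `ℚ(ev)`-locus `W` of `P_{j₀} = (q_{j₀}, e^{q_{j₀}})` is Zariski
closed of dimension `≤ #T` (`genericSliceVariety`), hence `dim W + rank Λ ≤ #T + rank Λ < #ι`, and contains every `P_j`,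
`j ∈ J` (one direction of the common-type hypothesis); FCS⁺ for this `W` is the conclusion.  The hypotheses `j₀ ∈ J`,
`2 ≤ #T` and the `K`-algebraic independence of `T` are not used. [cite: Matsumura1987, Thm 5.6] -/
theorem stub_genericSparsity_of_fcsPlus : (∀ (ι : Type) [Fintype ι] (i₀ : ι) (W : Set (ι ⊕ ι → ℂ)) (c : ℂ) (J : Set ℤ) (q : ℤ → ι → ℂ) (Λ : Submodule ℤ (ι → ℤ)), Literature.NumberTheory.Transcendental.IsZariskiClosed ℂ W → Literature.NumberTheory.Transcendental.zariskiDim ℂ W + ((Module.finrank ℤ ↥Λ : ℕ) : WithBot ℕ∞) < ((Fintype.card ι : ℕ) : WithBot ℕ∞) → (∀ j ∈ J, LinearIndependent ℚ (q j) ∧ Sum.elim (q j) (Complex.exp ∘ q j) ∈ W ∧ q j i₀ = c + 2 * ↑Real.pi * Complex.I * (j : ℂ)) → (∀ ω : ι → ℂ, Set.Finite {j : ℤ | j ∈ J ∧ Complex.exp ∘ q j = ω}) → (∀ M ∈ Λ, ∀ j ∈ J, ∀ j' ∈ J, (∑ i, (M i : ℂ) * q j i) = ∑ i, (M i : ℂ)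 * q j' i) → (∀ J' ⊆ J, (∃ δ : ℝ, 0 < δ ∧ ∀ N₀ : ℕ, ∃ N : ℕ, N₀ ≤ N ∧ ∃ a : ℤ, δ * (N : ℝ) ≤ (Set.ncard {j : ℤ | j ∈ Finset.Ico a (a + (N : ℤ)) ∧ j ∈ J'} : ℝ)) → ∀ M : ι → ℤ, (∀ m : ℤ, m ≠ 0 → m • M ∉ Λ) → Set.Infinite ((fun j => ∑ i, (M i : ℂ) * q j i) '' J')) → ∀ δ : ℝ, 0 < δ → ∃ N₀ : ℕ, ∀ N : ℕ, N₀ ≤ N → ∀ a : ℤ, (Set.ncard {j : ℤ | j ∈ Finset.Ico a (a + (N : ℤ)) ∧ j ∈ J} : ℝ) < δ * (N : ℝ)) → ∀ (ι : Type) [Fintype ι] (i₀ : ι) (c : ℂ) (J : Set ℤ) (q : ℤ → ι → ℂ) (Λ : Submodule ℤ (ι → ℤ)) (κ : Type) (ev : κ → ℂ) (j₀ : ℤ) (T : Finset (ι ⊕ ι)), j₀ ∈ J → 2 ≤ T.card → T.card + Module.finrank ℤ ↥Λ < Fintype.card ι → (∀ j ∈ J, LinearIndependent ℚ (q j) ∧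 q j i₀ = c + 2 * ↑Real.pi * Complex.I * (j : ℂ)) → (∀ ω : ι → ℂ, Set.Finite {j : ℤ | j ∈ J ∧ Complex.exp ∘ q j = ω}) → (∀ M ∈ Λ, ∀ j ∈ J, ∀ j' ∈ J, (∑ i, (M i : ℂ) * q j i) = ∑ i, (M i : ℂ) * q j' i) → (∀ j ∈ J, ∀ H : MvPolynomial (κ ⊕ (ι ⊕ ι)) ℚ, MvPolynomial.aeval (Sum.elim ev (Sum.elim (q j₀) (Complex.exp ∘ q j₀))) H = 0 ↔ MvPolynomial.aeval (Sum.elim ev (Sum.elim (q j) (Complex.exp ∘ q j))) H = 0) → AlgebraicIndependent ↥(IntermediateField.adjoin ℚ (Set.range ev)) (fun t : ↥T => Sum.elim (q j₀) (Complex.exp ∘ q j₀) (↑t : ι ⊕ ι)) → (∀ v : ι ⊕ ι, IsAlgebraic ↥(Algebra.adjoin ↥(IntermediateField.adjoin ℚ (Set.range ev)) ((Sum.elim (q j₀) (Complex.exp ∘ q j₀)) '' (↑T : Set (ι ⊕ ι)))) (Sum.elim (q j₀) (Complex.exp ∘ q j₀) v)) → (∀ J' ⊆ J, (∃ δ : ℝ,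 0 < δ ∧ ∀ N₀ : ℕ, ∃ N : ℕ, N₀ ≤ N ∧ ∃ a : ℤ, δ * (N : ℝ) ≤ (Set.ncard {j : ℤ | j ∈ Finset.Ico a (a + (N : ℤ)) ∧ j ∈ J'} : ℝ)) → ∀ M : ι → ℤ, (∀ m : ℤ, m ≠ 0 → m • M ∉ Λ) → Set.Infinite ((fun j => ∑ i, (M i : ℂ) * q j i) '' J')) → ∀ δ : ℝ, 0 < δ → ∃ N₀ : ℕ, ∀ N : ℕ, N₀ ≤ N → ∀ a : ℤ, (Set.ncard {j : ℤ | j ∈ Finset.Ico a (a + (N : ℤ)) ∧ j ∈ J} : ℝ) < δ * (N : ℝ) := by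
  intro hF ι _ i₀ c J q Λ κ ev j₀ T _ _ hdim hpts hfib hdead hiff _ halg hfree
  -- the generic slice variety: the `ℚ(ev)`-locus of `P_{j₀}`
  obtain ⟨W, hWcl, hWdim, hWmem⟩ :=
    genericSliceVariety ev (Sum.elim (q j₀) (Complex.exp ∘ q j₀)) T halg
  refine hF ι i₀ W c J q Λ hWcl ?_
    (fun j hj => ⟨(hpts j hj).1, hWmem _ fun H hH => (hiff j hj H).1 hH, (hpts j hj).2⟩) hfib hdead hfree
  calc zariskiDim ℂ W + ((Module.finrank ℤ ↥Λ : ℕ) : WithBot ℕ∞)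
      ≤ ((T.card : ℕ) : WithBot ℕ∞) + ((Module.finrank ℤ ↥Λ : ℕ) : WithBot ℕ∞) := add_le_add hWdim le_rfl
    _ < ((Fintype.card ι : ℕ) : WithBot ℕ∞) := by exact_mod_cast hdim

end Summit.Schanuel.Schanuel.Cruxes.MinimalCounterexampleInAcl.KernelArithmeticSelection

end
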